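import Summits.MatrixMultiplication.MatrixMultiplication.Theorems.AbelianSTPPCensusTB2StatDefs

/-!
# T_B static certificate, orders `5001 … 5215` (theory's t*-indexed linear checker at `τ = 2375/1000`): kernel evaluation, the domination checks, volumes `1672 … 2119`

Cell mm-stpp (rung F-M1), tier T_B = «beat `2.375` (Coppersmith–Winograd)»; checker in `AbelianSTPPCensusTB2StatDefs.lean`, table in `AbelianSTPPCensusTB2StatData.lean`
(pattern: theory g12's `AbelianSTPPCensusTAStatCDom*.lean`).  `decide` with kernel reduction (standard axioms; no `native_decide`), `Elab.async false`;
consumed by `TB2Stat.checkV_sound` / `TB2Stat.domV_sound` in the leaf `AbelianSTPPCensusLeafTB5215Closed.lean`.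
the domination checks, volumes `1672 … 2119` THIS IS NOT: arithmetic on shape lists only; no statement about STPP families or `ω`.
-/

set_option linter.dupNamespace false
set_option autoImplicit false
set_option Elab.async false

namespace Summit.MatrixMultiplication.MatrixMultiplication.Theorems.TB2Stat

set_option maxHeartbeats 0 in
/-- Domination chunk: every sorted candidate shape of the volumes `1672 … 1784` is dominated by the table (896 shapes). [original] -/
theorem dom1672 : TB2Stat.domV 113 1672 = true := by decide +kernel

set_option maxHeartbeats 0 in
/-- Domination chunk: every sorted candidate shape of the volumes `1785 … 1897` is dominated by the table (898 shapes). [original] -/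
theorem dom1785 : TB2Stat.domV 113 1785 = true := by decide +kernel

set_option maxHeartbeats 0 in
/-- Domination chunk: every sorted candidate shape of the volumes `1898 … 2012` is dominated by the table (896 shapes). [original] -/
theorem dom1898 : TB2Stat.domV 115 1898 = true := by decide +kernel

set_option maxHeartbeats 0 in
/-- Domination chunk: every sorted candidate shape of the volumes `2013 … 2119` is dominated by the table (888 shapes). [original] -/
theorem dom2013 : TB2Stat.domV 107 2013 = true := by decide +kernel

end Summit.MatrixMultiplication.MatrixMultiplication.Theorems.TB2Stat
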